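import Summits.AtomisticToContinuum.Crystallization.Theorems.FrustratedLawDichotomyStrainedPatchHomSplit

/-!
# The homogeneous floor (H) cut by FRAME ZONE and SHUFFLE TUBE («XiWindow», lens-5 g100; critic rows 1481 (D) ①, 1611 (B) (γ) / (E∣U-far))

`HomFloor m` (`…StrainedPatchHomSplit` §2) prices EVERY admissible homogeneous instance `IsHomBall (133/10)`: a deformed fcc lattice, or a deformed
hcp two-lattice with frame `G` (`‖G − 1‖ ≤ 1/4`) and internal shuffle `ξ` (`‖ξ‖ ≤ 1/4`).  Row 1481 (D) ① asked whether the family can be NARROWED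
(`‖G − 1‖ ≤ 1/8`, `‖ξ‖ ≤ 1/16`) «for free».  ANSWER OF RECORD (memo `XI100.md`, desk numerics `xi100.py`, lens-5 g100):

* BY SOURCE — NO.  Every consumer of (H) (`NearHom`, `TubeRelief`, `CoreCoreRelief`, `MonoCoreTubeFloor`) takes an ARBITRARY `Admissible ∧ IsHomBall (133/10)`
  witness; no decl of the tree bounds `‖ξ‖` below `1/4` or `‖G − 1‖` below `1/4` on admissible instances.
* `G` — NOT NARROWABLE BY ADMISSIBILITY AT ALL: isotropic rescaling `σ·U⋆`, `σ ∈ [0.78, 1.25]`, keeps the misfit in the band `[1/20, 1/8)` and the shuffle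
  force zero, so admissible instances fill the dilation axis of `‖G − 1‖ ≤ 1/4` end to end; the far-`U` field is an ENERGY piece (huge margins: `+0.046` per
  site at `σ = 1.05`, `+0.56` at `0.90`, against `m = 1/625`), typed below as `HomFloorHcp (¬ Zone)` / `HomFloorFcc`.
* `ξ` FLAT WINDOW `‖ξ‖ ≤ 1/16` — FALSE on the desk: `E2g`-strained members (`e_xx − e_yy ≈ .12 … .16`, misfit `.09 … .122 < 1/8`, force `0`) carry a relaxed
  shuffle `‖ξ⋆‖ = .062 … .091 > 1/16`.  FLAT WINDOW `‖ξ‖ ≤ 1/8` — holds on the desk on the bond-capped zone `BondCap (107/100)` with force margin `≥ 5σ₁`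
  (binding: dilated members at the cap near `‖ξ‖ = 1/4`, and drifting sheets of `E2g`-strained members near `‖ξ‖ = 1/8`); CERTIFIABLE by the Steele /
  first-star force floor (single-layer lattice sum = Bessel-`K` closed form, reproduced to `1e-5`; stars 2/3 = `9 %`/`3 %` of star 1; `d log c₁/dh = −18`,
  i.e. MULTIPLICATIVE control on `U`-cells of width `≈ .05`), `O(10²–10³)` `U`-cells — versus `≈ 6e6` core-h by boxes (row 1611 (R4), NOT AUTHORISED).
* THE LEVER THAT MAKES ξ-DISPOSAL `O(1)` PER FRAME is the SHEET-CENTRED tube `‖ξ − σ̂ G‖ ≤ r`, `r = 1/64 … 1/32`, around a cellwise-constant approximate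
  force-free shuffle `σ̂` (desk: tube radius at `|F| = σ₁` is `≤ .0038` on the zone, force `≥ 3σ₁` at `1/64`, `≥ 6σ₁` at `1/32`), typed as `XiTube Zone σ̂ r`.

THIS FILE (generic in the zone `Zone`, the sheet `σ̂` and the radius `r`; all cuts EXACT by `em`; 0 sorry):
§1 `IsFccBallIn Zf` / `IsHcpBallIn Zh` = the two branches of `IsHomBall` with the witness `(G, ξ)` exposed and constrained; `isHomBall_iff_fcc_or_hcp`.
§2 `HomFloorFcc Zf m`, `HomFloorHcp Zh m`; `homFloor_iff_fcc_and_hcp`; zone splits `homFloorHcp_split` / `homFloorFcc_split` (exact); monotonicity.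
§3 `XiTube Zh σ̂ r` [ADMISSIBILITY LEMMA SHAPE · UNDECIDED · INSTRUMENT = Steele first-star force floor, uniform in `U`], `XiConfined Zh ρ := XiTube Zh 0 ρ`;
   `homFloorHcp_of_xiTube` (the tube piece suffices on the zone), `homFloorHcp_far_of_xiTube` (the off-tube piece is VACUOUS), `xiConfined_quarter` (trivial edge).
§4 ASSEMBLY `homFloor_of_windowPieces : HomFloorFcc ⊤ m → XiTube Zone σ̂ r → HomFloorHcp (Zone ∧ tube) m → HomFloorHcp (¬Zone) m → HomFloor m`, its
   necessity companions (every `HomFloor…` piece follows from `HomFloor m`), and the record corollary to `StrainedPatchRec` through the g43 seam.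
§5 `BondCap ℓ G` — the concrete zone of the memo (the six reference nearest-neighbour bonds of the hcp two-lattice have deformed length `≤ ℓ`; record `ℓ = 107/100`,
   just below the Lennard-Jones inflection `(13/7)^(1/6) = 1.109` beyond which the shuffle stiffness changes sign: desk `K_min = +2.2` at bond `1.066`, `−1.8` at `1.18`).
TAGS: (H∣tube) `HomFloorHcp (BondCap ∧ tube)` INSTRUMENTABLE (sheet leaf + HCC, r1611 (R4) line) · `XiTube (BondCap (107/100)) σ̂ (1/64)` UNDECIDED·ANALYTIC-INSTRUMENT ·
(E∣U-far) `HomFloorHcp (¬BondCap)` + the in-zone far shells INSTRUMENTABLE-IN-PRINCIPLE, NOT by 6-D boxes (`≈ 4e5` core-h at `2⁻⁶`): lever = tier-1 nearest-shell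
bound + stiff-direction convexity reduction to the 4-D soft (`E2g ⊕ E1g`) family (memo §5) · `HomFloorFcc ⊤` = the fcc half (unchanged, T-architecture).
No new axioms, no sorry, no instances / notation / set_option.  Evidence: `run/shared/lean/pub/decomp-a2c/decomp-a2c-lens-5/g100/{memo/XI100.md, num/}`.
-/

namespace Summit.AtomisticToContinuum.Crystallization.Theorems.FrustratedLawDichotomyStrainedPatchHomXiWindow

open scoped BigOperators Classical
open Summit.AtomisticToContinuum.Crystallization.Theorems.FrustratedLawDichotomyRangeCut
open Summit.AtomisticToContinuum.Crystallization.Theorems.FrustratedLawDichotomyAveragingCut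
open Summit.AtomisticToContinuum.Crystallization.Theorems.FrustratedLawDichotomyStrainedPatchHomSplit

/-! ## §1. The two branches of `IsHomBall` with the witness exposed -/

/-- The point set of the deformed hcp two-lattice instance with frame `G`, shuffle `ξ`, centre `x₀`, radius `R` (verbatim from `IsHomBall`). -/
def hcpSet (G : E3 →L[ℝ] E3) (ξ x₀ : E3) (R : ℝ) : Set E3 :=
  {x | dist x x₀ ≤ R ∧ ∃ a : Fin 3 → ℤ, x = x₀ + latPt G hexFrame a ∨ x = x₀ + latPt G hexFrame a + G (hcpShift + ξ)}

/-- The point set of the deformed fcc instance with frame `G`, centre `x₀`, radius `R` (verbatim from `IsHomBall`). -/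
def fccSet (G : E3 →L[ℝ] E3) (x₀ : E3) (R : ℝ) : Set E3 :=
  {x | dist x x₀ ≤ R ∧ ∃ a : Fin 3 → ℤ, x = x₀ + latPt G Literature.Barriers.AtomisticToContinuum.FlatleyTheil2015.fccVec a}

/-- **fcc branch in zone `Zf`**: the cluster is a homogeneous fcc ball whose frame `G` satisfies `Zf G`. -/
def IsFccBallIn (Zf : (E3 →L[ℝ] E3) → Prop) (R : ℝ) {M : ℕ} (z : Fin M → E3) (c : Fin M) : Prop :=
  ∃ G : E3 →L[ℝ] E3, ‖G - 1‖ ≤ 1 / 4 ∧ Zf G ∧ Set.range z = fccSet G (z c) R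

/-- **hcp branch in zone `Zh`**: the cluster is a homogeneous hcp ball whose frame/shuffle pair `(G, ξ)` satisfies `Zh G ξ`. -/
def IsHcpBallIn (Zh : (E3 →L[ℝ] E3) → E3 → Prop) (R : ℝ) {M : ℕ} (z : Fin M → E3) (c : Fin M) : Prop :=
  ∃ (G : E3 →L[ℝ] E3) (ξ : E3), ‖G - 1‖ ≤ 1 / 4 ∧ ‖ξ‖ ≤ 1 / 4 ∧ Zh G ξ ∧ Set.range z = hcpSet G ξ (z c) R

/-- `IsHomBall` is the disjunction of its two branches with the trivial zones. [formal bookkeeping] -/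
theorem isHomBall_iff_fcc_or_hcp {R : ℝ} {M : ℕ} {z : Fin M → E3} {c : Fin M} :
    IsHomBall R z c ↔ IsFccBallIn (fun _ => True) R z c ∨ IsHcpBallIn (fun _ _ => True) R z c := by
  constructor
  · rintro ⟨G, ξ, hG, hξ, h | h⟩
    · exact Or.inl ⟨G, hG, trivial, h⟩
    · exact Or.inr ⟨G, ξ, hG, hξ, trivial, h⟩
  · rintro (⟨G, hG, -, h⟩ | ⟨G, ξ, hG, hξ, -, h⟩)
    · refine ⟨G, 0, hG, ?_, Or.inl h⟩
      rw [norm_zero]; norm_num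
    · exact ⟨G, ξ, hG, hξ, Or.inr h⟩

/-- Shrinking the zone weakens the branch predicate. -/
theorem IsHcpBallIn.mono {Zh Zh' : (E3 →L[ℝ] E3) → E3 → Prop} (hZ : ∀ G ξ, Zh G ξ → Zh' G ξ) {R : ℝ} {M : ℕ} {z : Fin M → E3} {c : Fin M}
    (h : IsHcpBallIn Zh R z c) : IsHcpBallIn Zh' R z c := by
  obtain ⟨G, ξ, hG, hξ, hz, hr⟩ := h
  exact ⟨G, ξ, hG, hξ, hZ G ξ hz, hr⟩

/-- [formal bookkeeping; lane docstring, hand-2 g42] -/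
theorem IsFccBallIn.mono {Zf Zf' : (E3 →L[ℝ] E3) → Prop} (hZ : ∀ G, Zf G → Zf' G) {R : ℝ} {M : ℕ} {z : Fin M → E3} {c : Fin M}
    (h : IsFccBallIn Zf R z c) : IsFccBallIn Zf' R z c := by
  obtain ⟨G, hG, hz, hr⟩ := h
  exact ⟨G, hG, hZ G hz, hr⟩

/-! ## §2. The floor restricted to a branch and a zone; exact zone splits -/

/-- **(H∣fcc, `Zf`)** the homogeneous floor on admissible fcc instances whose frame lies in `Zf`. -/
def HomFloorFcc (Zf : (E3 →L[ℝ] E3) → Prop) (m : ℝ) : Prop :=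
  ∀ (M : ℕ) (z : Fin M → E3) (c : Fin M), Admissible M z c → IsFccBallIn Zf (133 / 10) z c → m ≤ ballAvg (9 / 5) z (xRec M z) c

/-- **(H∣hcp, `Zh`)** the homogeneous floor on admissible hcp instances whose `(G, ξ)` lies in `Zh`. -/
def HomFloorHcp (Zh : (E3 →L[ℝ] E3) → E3 → Prop) (m : ℝ) : Prop :=
  ∀ (M : ℕ) (z : Fin M → E3) (c : Fin M), Admissible M z c → IsHcpBallIn Zh (133 / 10) z c → m ≤ ballAvg (9 / 5) z (xRec M z) c

/-- ★ EXACT CUT by phase: `HomFloor m ↔ (H∣fcc, ⊤) ∧ (H∣hcp, ⊤)`. [formal bookkeeping] -/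
theorem homFloor_iff_fcc_and_hcp {m : ℝ} :
    HomFloor m ↔ HomFloorFcc (fun _ => True) m ∧ HomFloorHcp (fun _ _ => True) m := by
  constructor
  · intro h
    exact ⟨fun M z c hz hh => h M z c hz (isHomBall_iff_fcc_or_hcp.mpr (Or.inl hh)),
      fun M z c hz hh => h M z c hz (isHomBall_iff_fcc_or_hcp.mpr (Or.inr hh))⟩
  · rintro ⟨hf, hh⟩ M z c hz hhom
    rcases isHomBall_iff_fcc_or_hcp.mp hhom with h | h
    · exact hf M z c hz h
    · exact hh M z c hz h

/-- A larger zone is a stronger floor. -/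
theorem HomFloorHcp.mono_zone {Zh Zh' : (E3 →L[ℝ] E3) → E3 → Prop} {m : ℝ} (h : HomFloorHcp Zh m) (hZ : ∀ G ξ, Zh' G ξ → Zh G ξ) :
    HomFloorHcp Zh' m :=
  fun M z c hz hh => h M z c hz (hh.mono hZ)

/-- [formal bookkeeping; lane docstring, hand-2 g42] -/
theorem HomFloorFcc.mono_zone {Zf Zf' : (E3 →L[ℝ] E3) → Prop} {m : ℝ} (h : HomFloorFcc Zf m) (hZ : ∀ G, Zf' G → Zf G) :
    HomFloorFcc Zf' m :=
  fun M z c hz hh => h M z c hz (hh.mono hZ)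

/-- Level monotonicity. -/
theorem HomFloorHcp.mono {Zh : (E3 →L[ℝ] E3) → E3 → Prop} {m m' : ℝ} (h : HomFloorHcp Zh m) (hle : m' ≤ m) : HomFloorHcp Zh m' :=
  fun M z c hz hh => hle.trans (h M z c hz hh)

/-- [formal bookkeeping; lane docstring, hand-2 g42] -/
theorem HomFloorFcc.mono {Zf : (E3 →L[ℝ] E3) → Prop} {m m' : ℝ} (h : HomFloorFcc Zf m) (hle : m' ≤ m) : HomFloorFcc Zf m' :=
  fun M z c hz hh => hle.trans (h M z c hz hh)

/-- ★ EXACT ZONE SPLIT (hcp branch): the floor on `Zh` is the floor on `Zh ∧ P` together with the floor on `Zh ∧ ¬P`. [`em`] -/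
theorem homFloorHcp_split (Zh P : (E3 →L[ℝ] E3) → E3 → Prop) {m : ℝ} :
    HomFloorHcp Zh m ↔ HomFloorHcp (fun G ξ => Zh G ξ ∧ P G ξ) m ∧ HomFloorHcp (fun G ξ => Zh G ξ ∧ ¬P G ξ) m := by
  constructor
  · intro h
    exact ⟨h.mono_zone fun G ξ hG => hG.1, h.mono_zone fun G ξ hG => hG.1⟩
  · rintro ⟨h₁, h₂⟩ M z c hz ⟨G, ξ, hG, hξ, hZ, hr⟩
    by_cases hP : P G ξ
    · exact h₁ M z c hz ⟨G, ξ, hG, hξ, ⟨hZ, hP⟩, hr⟩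
    · exact h₂ M z c hz ⟨G, ξ, hG, hξ, ⟨hZ, hP⟩, hr⟩

/-- ★ EXACT ZONE SPLIT (fcc branch). [`em`] -/
theorem homFloorFcc_split (Zf P : (E3 →L[ℝ] E3) → Prop) {m : ℝ} :
    HomFloorFcc Zf m ↔ HomFloorFcc (fun G => Zf G ∧ P G) m ∧ HomFloorFcc (fun G => Zf G ∧ ¬P G) m := by
  constructor
  · intro h
    exact ⟨h.mono_zone fun G hG => hG.1, h.mono_zone fun G hG => hG.1⟩
  · rintro ⟨h₁, h₂⟩ M z c hz ⟨G, hG, hZ, hr⟩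
    by_cases hP : P G
    · exact h₁ M z c hz ⟨G, hG, ⟨hZ, hP⟩, hr⟩
    · exact h₂ M z c hz ⟨G, hG, ⟨hZ, hP⟩, hr⟩

/-! ## §3. The shuffle tube: an admissibility lemma, not an energy estimate -/

/-- **`XiTube Zh σ̂ r` [UNDECIDED · ANALYTIC INSTRUMENT]** — on the zone `Zh`, every ADMISSIBLE homogeneous hcp instance has its shuffle within `r` of the sheet
value `σ̂ G`: the per-site force cap carried by `¬ExemptNear` (`|F| ≤ σ₁` at move tolerance `0`) excludes the far shuffle field.  Desk (XI-100): on
`BondCap (107/100)` the force-free sheet is a non-degenerate minimum with tube radius `≤ .0038` and `|F| ≥ 3σ₁` at distance `1/64`; certificate = Steele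
first-star force floor, uniform on `U`-cells of width `≈ .05`. -/
def XiTube (Zh : (E3 →L[ℝ] E3) → E3 → Prop) (σ : (E3 →L[ℝ] E3) → E3) (r : ℝ) : Prop :=
  ∀ (M : ℕ) (z : Fin M → E3) (c : Fin M) (G : E3 →L[ℝ] E3) (ξ : E3), Admissible M z c → ‖G - 1‖ ≤ 1 / 4 → ‖ξ‖ ≤ 1 / 4 → Zh G ξ →
    Set.range z = hcpSet G ξ (z c) (133 / 10) → ‖ξ - σ G‖ ≤ r

/-- **`XiConfined Zh ρ`** — the FLAT window (tube around the zero sheet): admissible hcp instances in `Zh` have `‖ξ‖ ≤ ρ`.  Desk: `ρ = 1/8` holds on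
`BondCap (107/100)` with force margin `≥ 5σ₁`; `ρ = 1/16` is FALSE (E2g-strained members, `‖ξ⋆‖` up to `.091`). -/
def XiConfined (Zh : (E3 →L[ℝ] E3) → E3 → Prop) (ρ : ℝ) : Prop := XiTube Zh (fun _ => 0) ρ

/-- [formal bookkeeping; lane docstring, hand-2 g42] -/
theorem xiConfined_iff (Zh : (E3 →L[ℝ] E3) → E3 → Prop) (ρ : ℝ) :
    XiConfined Zh ρ ↔ ∀ (M : ℕ) (z : Fin M → E3) (c : Fin M) (G : E3 →L[ℝ] E3) (ξ : E3), Admissible M z c → ‖G - 1‖ ≤ 1 / 4 → ‖ξ‖ ≤ 1 / 4 →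
      Zh G ξ → Set.range z = hcpSet G ξ (z c) (133 / 10) → ‖ξ‖ ≤ ρ := by
  unfold XiConfined XiTube
  simp only [sub_zero]

/-- The trivial edge: the flat window at `1/4` is `IsHomBall`'s own cap. -/
theorem xiConfined_quarter (Zh : (E3 →L[ℝ] E3) → E3 → Prop) : XiConfined Zh (1 / 4) :=
  (xiConfined_iff Zh _).mpr fun _ _ _ _ _ _ _ hξ _ _ => hξ

/-- Radius monotonicity of the tube. -/
theorem XiTube.mono {Zh : (E3 →L[ℝ] E3) → E3 → Prop} {σ : (E3 →L[ℝ] E3) → E3} {r r' : ℝ} (h : XiTube Zh σ r) (hle : r ≤ r') : XiTube Zh σ r' :=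
  fun M z c G ξ hz hG hξ hZ hr => (h M z c G ξ hz hG hξ hZ hr).trans hle

/-- Zone monotonicity of the tube (a smaller zone is a weaker lemma). -/
theorem XiTube.mono_zone {Zh Zh' : (E3 →L[ℝ] E3) → E3 → Prop} {σ : (E3 →L[ℝ] E3) → E3} {r : ℝ} (h : XiTube Zh σ r)
    (hZ : ∀ G ξ, Zh' G ξ → Zh G ξ) : XiTube Zh' σ r :=
  fun M z c G ξ hz hG hξ hin hr => h M z c G ξ hz hG hξ (hZ G ξ hin) hr

/-- ★ THE TUBE PIECE SUFFICES ON THE ZONE: `XiTube Zh σ̂ r ∧ (H∣hcp, Zh ∧ ‖ξ − σ̂ G‖ ≤ r) ⟹ (H∣hcp, Zh)`. [three lines] -/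
theorem homFloorHcp_of_xiTube {Zh : (E3 →L[ℝ] E3) → E3 → Prop} {σ : (E3 →L[ℝ] E3) → E3} {r m : ℝ} (hT : XiTube Zh σ r)
    (hW : HomFloorHcp (fun G ξ => Zh G ξ ∧ ‖ξ - σ G‖ ≤ r) m) : HomFloorHcp Zh m := by
  rintro M z c hz ⟨G, ξ, hG, hξ, hZ, hr⟩
  exact hW M z c hz ⟨G, ξ, hG, hξ, ⟨hZ, hT M z c G ξ hz hG hξ hZ hr⟩, hr⟩

/-- The OFF-TUBE piece is VACUOUS under the tube lemma (any level `m`). -/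
theorem homFloorHcp_far_of_xiTube {Zh : (E3 →L[ℝ] E3) → E3 → Prop} {σ : (E3 →L[ℝ] E3) → E3} {r : ℝ} (hT : XiTube Zh σ r) (m : ℝ) :
    HomFloorHcp (fun G ξ => Zh G ξ ∧ ¬‖ξ - σ G‖ ≤ r) m := by
  rintro M z c hz ⟨G, ξ, hG, hξ, ⟨hZ, hfar⟩, hr⟩
  exact absurd (hT M z c G ξ hz hG hξ hZ hr) hfar

/-- Conversely the tube piece is a restriction of the zone piece (so the cut `(H∣hcp, Zh) ↔ tube piece ∧ off-tube piece` is `homFloorHcp_split`). -/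
theorem homFloorHcp_tube_of_zone {Zh : (E3 →L[ℝ] E3) → E3 → Prop} (σ : (E3 →L[ℝ] E3) → E3) (r : ℝ) {m : ℝ} (h : HomFloorHcp Zh m) :
    HomFloorHcp (fun G ξ => Zh G ξ ∧ ‖ξ - σ G‖ ≤ r) m :=
  h.mono_zone fun _ _ hG => hG.1

/-! ## §4. Assembly of (H) from the four pieces; necessity; record corollary -/

/-- ★★ **ASSEMBLY**: fcc half ∧ tube lemma on the zone ∧ hcp floor on (zone ∧ tube) ∧ hcp floor off the zone ⟹ `HomFloor m`. -/
theorem homFloor_of_windowPieces (Zone : (E3 →L[ℝ] E3) → Prop) (σ : (E3 →L[ℝ] E3) → E3) (r : ℝ) {m : ℝ}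
    (hF : HomFloorFcc (fun _ => True) m) (hT : XiTube (fun G _ => Zone G) σ r)
    (hE : HomFloorHcp (fun G ξ => Zone G ∧ ‖ξ - σ G‖ ≤ r) m) (hU : HomFloorHcp (fun G _ => ¬Zone G) m) : HomFloor m := by
  refine homFloor_iff_fcc_and_hcp.mpr ⟨hF, ?_⟩
  refine (homFloorHcp_split (fun _ _ => True) (fun G _ => Zone G)).mpr ⟨?_, ?_⟩
  · exact (homFloorHcp_of_xiTube hT hE).mono_zone fun G ξ hG => hG.2
  · exact hU.mono_zone fun G ξ hG => hG.2

/-- NECESSITY: every branch/zone piece follows from `HomFloor m` (the cut loses nothing; only `XiTube` is extra knowledge). -/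
theorem homFloorHcp_of_homFloor {m : ℝ} (h : HomFloor m) (Zh : (E3 →L[ℝ] E3) → E3 → Prop) : HomFloorHcp Zh m :=
  (homFloor_iff_fcc_and_hcp.mp h).2.mono_zone fun _ _ _ => trivial

/-- [formal bookkeeping; lane docstring, hand-2 g42] -/
theorem homFloorFcc_of_homFloor {m : ℝ} (h : HomFloor m) (Zf : (E3 →L[ℝ] E3) → Prop) : HomFloorFcc Zf m :=
  (homFloor_iff_fcc_and_hcp.mp h).1.mono_zone fun _ _ => trivial

/-- ★ EXACT THREE-WAY CUT of (H) at any zone/sheet/radius: `HomFloor m ↔ fcc ∧ hcp-in-tube ∧ hcp-off-tube-in-zone ∧ hcp-off-zone`. [`em` twice] -/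
theorem homFloor_iff_windowPieces (Zone : (E3 →L[ℝ] E3) → Prop) (σ : (E3 →L[ℝ] E3) → E3) (r : ℝ) {m : ℝ} :
    HomFloor m ↔ HomFloorFcc (fun _ => True) m ∧ HomFloorHcp (fun G ξ => Zone G ∧ ‖ξ - σ G‖ ≤ r) m ∧
      HomFloorHcp (fun G ξ => Zone G ∧ ¬‖ξ - σ G‖ ≤ r) m ∧ HomFloorHcp (fun G _ => ¬Zone G) m := by
  constructor
  · intro h
    exact ⟨homFloorFcc_of_homFloor h _, homFloorHcp_of_homFloor h _, homFloorHcp_of_homFloor h _, homFloorHcp_of_homFloor h _⟩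
  · rintro ⟨hF, hE, hO, hU⟩
    refine homFloor_iff_fcc_and_hcp.mpr ⟨hF, (homFloorHcp_split (fun _ _ => True) (fun G _ => Zone G)).mpr ⟨?_, hU.mono_zone fun G ξ hG => hG.2⟩⟩
    exact ((homFloorHcp_split (fun G _ => Zone G) (fun G ξ => ‖ξ - σ G‖ ≤ r)).mpr ⟨hE, hO⟩).mono_zone fun G ξ hG => hG.2

/-- ★ RECORD COROLLARY: the four pieces + texture relief + seam arithmetic ⟹ `StrainedPatchRec` (through `strainedPatchRec_of_homFloor_of_relief`). -/
theorem strainedPatchRec_of_windowPieces (Zone : (E3 →L[ℝ] E3) → Prop) (σ : (E3 →L[ℝ] E3) → E3) (r : ℝ) {m L B : ℝ}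
    (hF : HomFloorFcc (fun _ => True) m) (hT : XiTube (fun G _ => Zone G) σ r)
    (hE : HomFloorHcp (fun G ξ => Zone G ∧ ‖ξ - σ G‖ ≤ r) m) (hU : HomFloorHcp (fun G _ => ¬Zone G) m)
    (hR : TextureReliefBound L B) (hm : L * sigmaOne + B ≤ m) : StrainedPatchRec :=
  strainedPatchRec_of_homFloor_of_relief (homFloor_of_windowPieces Zone σ r hF hT hE hU) hR hm

/-- Record arithmetic instance: level `1/625` with the g43 relief constants `(1/12, 1/4000)`. -/
theorem strainedPatchRec_of_windowPieces_625 (Zone : (E3 →L[ℝ] E3) → Prop) (σ : (E3 →L[ℝ] E3) → E3) (r : ℝ)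
    (hF : HomFloorFcc (fun _ => True) (1 / 625)) (hT : XiTube (fun G _ => Zone G) σ r)
    (hE : HomFloorHcp (fun G ξ => Zone G ∧ ‖ξ - σ G‖ ≤ r) (1 / 625)) (hU : HomFloorHcp (fun G _ => ¬Zone G) (1 / 625))
    (hR : TextureReliefBound (1 / 12) (1 / 4000)) : StrainedPatchRec :=
  strainedPatchRec_of_windowPieces Zone σ r hF hT hE hU hR seam_arith

/-! ## §5. The concrete zone of the memo: the nearest-neighbour bond cap -/

/-- **`BondCap ℓ G`** — the six reference nearest-neighbour bonds of the hcp two-lattice (three in the basal plane, three to the adjacent layer at zero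
shuffle) have deformed length `≤ ℓ`.  Record `ℓ = 107/100` (covers the E zone `‖U − U⋆‖ ≤ .07` of the floor-setting member, whose longest bond is `.997`;
stays below the Lennard-Jones inflection `1.109`). -/
def BondCap (ℓ : ℝ) (G : E3 →L[ℝ] E3) : Prop :=
  ‖G (hexFrame 0)‖ ≤ ℓ ∧ ‖G (hexFrame 1)‖ ≤ ℓ ∧ ‖G (hexFrame 1 - hexFrame 0)‖ ≤ ℓ ∧
    ‖G hcpShift‖ ≤ ℓ ∧ ‖G (hcpShift - hexFrame 0)‖ ≤ ℓ ∧ ‖G (hcpShift - hexFrame 1)‖ ≤ ℓ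

/-- `BondCap` is monotone in the cap. -/
theorem BondCap.mono {ℓ ℓ' : ℝ} {G : E3 →L[ℝ] E3} (h : BondCap ℓ G) (hle : ℓ ≤ ℓ') : BondCap ℓ' G :=
  ⟨h.1.trans hle, h.2.1.trans hle, h.2.2.1.trans hle, h.2.2.2.1.trans hle, h.2.2.2.2.1.trans hle, h.2.2.2.2.2.trans hle⟩

/-- ★ RECORD NODE (XI-100): with the bond-capped zone, a cellwise sheet `σ̂` and tube radius `1/64`,
`(H∣fcc) ∧ XiTube (BondCap 1.07) σ̂ (1/64) ∧ (H∣hcp, BondCap ∧ tube) ∧ (H∣hcp, ¬BondCap) ⟹ HomFloor (1/625)`. -/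
theorem homFloor_625_of_bondCapPieces (σ : (E3 →L[ℝ] E3) → E3)
    (hF : HomFloorFcc (fun _ => True) (1 / 625)) (hT : XiTube (fun G _ => BondCap (107 / 100) G) σ (1 / 64))
    (hE : HomFloorHcp (fun G ξ => BondCap (107 / 100) G ∧ ‖ξ - σ G‖ ≤ 1 / 64) (1 / 625))
    (hU : HomFloorHcp (fun G _ => ¬BondCap (107 / 100) G) (1 / 625)) : HomFloor (1 / 625) :=
  homFloor_of_windowPieces (fun G => BondCap (107 / 100) G) σ (1 / 64) hF hT hE hU

/-- The flat-window variant of record (`ρ = 1/8`, certifiable; `1/16` is not): `XiConfined (BondCap 1.07) (1/8)` and the floor on `‖ξ‖ ≤ 1/8` give the zone piece. -/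
theorem homFloorHcp_bondCap_of_flatWindow {m : ℝ} (hC : XiConfined (fun G _ => BondCap (107 / 100) G) (1 / 8))
    (hW : HomFloorHcp (fun G ξ => BondCap (107 / 100) G ∧ ‖ξ‖ ≤ 1 / 8) m) :
    HomFloorHcp (fun G _ => BondCap (107 / 100) G) m := by
  refine homFloorHcp_of_xiTube hC (hW.mono_zone fun G ξ hG => ⟨hG.1, ?_⟩)
  simpa only [sub_zero] using hG.2

end Summit.AtomisticToContinuum.Crystallization.Theorems.FrustratedLawDichotomyStrainedPatchHomXiWindow
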